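import Summits.ResolutionOfSingularities.ResolutionOfSingularities.Theorems.FrobeniusLadderFRationalResolutionAwayUnits
import Summits.ResolutionOfSingularities.ResolutionOfSingularities.Theorems.FrobeniusLadderFRationalResolutionCoarseningEtale
import Literature.AlgebraicGeometry.Resolution.TameQuotientSingularitiesResolutionProofs
import Literature.AlgebraicGeometry.Resolution.FiniteQuotientSingularityPresentation
import Mathlib.AlgebraicGeometry.Morphisms.Etale
import Mathlib.RingTheory.Localization.InvSubmonoid
import Mathlib.GroupTheory.Coset.Card
import HarnessLib

/-!
# Crux `FrobeniusLadder.FRationalResolution` (stmt-ResolutionOfSingularities-15317), line `redirect`,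
# stub `stub_diagonalizableQuotientResolution` — census item R3-tame ASSEMBLED: in the TAME case
# every point of `X` under a quotient chart `Spec S₀ → X` is the image of a FIXED point of another
# quotient chart of the same shape (`S_g` regular, graded by `A/B_𝔔`, étale over `X`)

The hypothesis `hq` of the stub gives, at `x ∈ X`, an étale chart `φ : Spec S₀ → X`, `S` regular
of finite type graded by the finite abelian group `A`. Let `v ↦ x`, `𝔔 ⊆ S` a prime over `v`
(`Spec S → Spec S₀` is onto), `B = B_𝔔` its unit-degree subgroup. By `…AwayUnits` there is
`g ∈ S₀ ∖ 𝔮` with global homogeneous units of all degrees `b ∈ B` in `S_g`; the grading of `S_g`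
(`locPiece`) coarsened along `A → A/B` (`…Coarsening`) has `𝔔 S_g` as a FIXED prime, and the
inclusion of degree-zero parts `(S₀)_g = (S_g)_0 → (S_g)^{(B)}` is finite étale when `|B|` is
invertible (`…CoarseningEtale`). Composing with the localization `S₀ → (S₀)_g` (étale) and `φ`:

* `isLocalizationAway_locPiece_zero` — `(S_g)_0` is `(S₀)_g` as an `S₀`-algebra
  (`IsLocalization.Away`), so `S₀ → (S_g)_0` is étale (`etale_locPieceZeroHom`);
* `exists_fixed_chart` — **for `|A| ∈ k^×`: a chart `φ' : Spec (S_g)^{(B)} → X` of the stub's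
  shape (`S_g` regular of finite type over `k`, graded by the finite group `A/B`, `φ'` étale and
  compatible with the structure maps) together with a prime `𝔔'` of `S_g` FIXED for the grading
  (`(S_g)'_c ⊆ 𝔔'` for `c ≠ 0`) whose image is `φ v = x`.**

So in the tame case the stub's `hq` may be assumed to present every point as the image of a
`D(A)`-fixed point — where `…FixedPointLogRegular` makes `Spec S₀` Kato-log-regular with a sharp
full-rank monomial chart (the toric local model `𝔸ⁿ/D(A)`); what remains for the stub is the
resolution of these local models compatibly along the étale charts (functorial toroidal
resolution / Bergh–Rydh destackification; the isolated-singularity case via an `𝔪`-primary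
monomial centre, `…PrimaryCentreEtale`). Honest label: brick R3-tame assembled, no stub closed.
No definitions, no named facts, no sorry. [folklore; cite: SGA1, Exp. I Prop. 7.6; SGA3,
Exp. VIII §4–5; EGAII, (2.2.1)–(2.2.2)]
-/

noncomputable section

-- single-problem summit: the doubled namespace component is forced
set_option linter.dupNamespace false

open CategoryTheory AlgebraicGeometry
open Literature.RingTheory.GradedAlgebra
open Literature.AlgebraicGeometry.Resolution
open Literature.AlgebraicGeometry.Resolution.DiagonalizableQuotient

namespace Summit.ResolutionOfSingularities.ResolutionOfSingularities.Theorems.FRationalResolution.FixedChart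

universe u v w

section Ring

variable {k : Type u} [CommRing k] {A : Type w} [DecidableEq A] [AddCommGroup A] {S : Type v}
  [CommRing S] [Algebra k S] (𝒮 : A → Submodule k S) [GradedAlgebra 𝒮]

/-- **`(S_g)_0 = (S_0)_g`**: the degree-zero part of the localization `S_g` (`g ∈ S_0`) is the
localization of `S_0` away from `g`, as an `S_0`-algebra through `locPieceZeroHom`.
[cite: EGAII, (2.2.2)] -/
theorem isLocalizationAway_locPiece_zero {g : S} (hg : g ∈ 𝒮 0)
    (hT : ∀ t ∈ Submonoid.powers g, t ∈ 𝒮 0)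
    (L : Type v) [CommRing L] [Algebra S L] [Algebra k L] [IsScalarTower k S L]
    [IsLocalization.Away g L] :
    letI := gradedMonoid_locPiece 𝒮 (Submonoid.powers g) hT L
    letI := locPieceZeroAlgebra 𝒮 (Submonoid.powers g) hT L
    IsLocalization.Away (⟨g, hg⟩ : 𝒮 0) (locPiece 𝒮 (Submonoid.powers g) hT L 0) := by
  letI := gradedMonoid_locPiece 𝒮 (Submonoid.powers g) hT L
  letI := locPieceZeroAlgebra 𝒮 (Submonoid.powers g) hT L
  have h := isLocalization_locPiece_zero 𝒮 (Submonoid.powers g) hT L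
  have hM : (Submonoid.powers g).comap (algebraMap (𝒮 0) S) = Submonoid.powers (⟨g, hg⟩ : 𝒮 0) := by
    ext x
    simp only [Submonoid.mem_comap, Submonoid.mem_powers_iff]
    constructor
    · rintro ⟨n, hn⟩
      exact ⟨n, Subtype.ext (by rw [SetLike.GradeZero.coe_pow]; exact hn)⟩
    · rintro ⟨n, hn⟩
      exact ⟨n, by rw [← hn, SetLike.GradeZero.algebraMap_apply, SetLike.GradeZero.coe_pow]⟩
  rw [IsLocalization.Away, ← hM]
  exact h

/-- **`S_0 → (S_g)_0` is étale** (a localization away from one element).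
[folklore; cite: EGAII, (2.2.2)] -/
theorem etale_locPieceZeroHom {g : S} (hg : g ∈ 𝒮 0) (hT : ∀ t ∈ Submonoid.powers g, t ∈ 𝒮 0)
    (L : Type v) [CommRing L] [Algebra S L] [Algebra k L] [IsScalarTower k S L]
    [IsLocalization.Away g L] :
    letI := gradedMonoid_locPiece 𝒮 (Submonoid.powers g) hT L
    (locPieceZeroHom 𝒮 (Submonoid.powers g) hT L).Etale := by
  letI := gradedMonoid_locPiece 𝒮 (Submonoid.powers g) hT L
  letI := locPieceZeroAlgebra 𝒮 (Submonoid.powers g) hT L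
  haveI := isLocalizationAway_locPiece_zero 𝒮 hg hT L
  show @Algebra.Etale (𝒮 0) (locPiece 𝒮 (Submonoid.powers g) hT L 0) _ _
    (locPieceZeroAlgebra 𝒮 (Submonoid.powers g) hT L)
  exact Algebra.Etale.of_isLocalizationAway (⟨g, hg⟩ : 𝒮 0)

end Ring

/-- **R3-tame assembled: every point under a tame quotient chart is the image of a FIXED point of
a quotient chart.** Let `φ : Spec S₀ → X` be a chart of the stub's shape (`S` regular of finite
type over the field `k`, graded by the finite abelian group `A`, `φ` étale with
`φ ≫ g = Spec (k → S₀)`) and assume `|A|` is invertible in `k` (tame). Then for every point `v`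
of `Spec S₀` there are a chart `φ' : Spec S'₀ → X` of the same shape — `S' = S_t` regular of
finite type graded by the finite group `A' = A/B` — and a prime `𝔔'` of `S'` contracting to a
point `v'` with `φ' v' = φ v`, which is FIXED: `S'_c ⊆ 𝔔'` for every `c ≠ 0`.
[folklore; cite: SGA1, Exp. I Prop. 7.6; SGA3, Exp. VIII §4–5] -/
theorem exists_fixed_chart (k : Type) [Field k] (X : Scheme.{0}) (g : X ⟶ Spec (.of k))
    (A : Type) [AddCommGroup A] [Finite A] [DecidableEq A] (S : Type) [CommRing S] [Algebra k S]
    (𝒮 : A → Submodule k S) [GradedAlgebra 𝒮] [Algebra.FiniteType k S] [IsRegularRing S]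
    (φ : Spec (.of (𝒮 0)) ⟶ X) [Etale φ]
    (hφg : φ ≫ g = Spec.map (CommRingCat.ofHom (algebraMap k (𝒮 0))))
    (htame : IsUnit ((Nat.card A : ℕ) : k)) (v : Spec (.of (𝒮 0))) :
    ∃ (A' : Type) (_ : AddCommGroup A') (_ : Finite A') (_ : DecidableEq A')
      (S' : Type) (_ : CommRing S') (_ : Algebra k S') (𝒮' : A' → Submodule k S')
      (_ : GradedAlgebra 𝒮'),
      Algebra.FiniteType k S' ∧ IsRegularRing S' ∧
      ∃ (φ' : Spec (.of (𝒮' 0)) ⟶ X), Etale φ' ∧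
        φ' ≫ g = Spec.map (CommRingCat.ofHom (algebraMap k (𝒮' 0))) ∧
        ∃ (v' : Spec (.of (𝒮' 0))) (𝔔' : Ideal S') (_ : 𝔔'.IsPrime),
          𝔔'.comap (algebraMap (𝒮' 0) S') = v'.asIdeal ∧
          (∀ c : A', c ≠ 0 → ∀ s ∈ 𝒮' c, s ∈ 𝔔') ∧ φ' v' = φ v := by
  classical
  have hA : AddMonoid.IsTorsion A := fun a => isOfFinAddOrder_of_finite a
  -- a prime of `S` over `v`
  obtain ⟨w, hw⟩ := comap_algebraMap_gradeZero_surjective 𝒮 hA v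
  let 𝔔 : Ideal S := w.asIdeal
  haveI h𝔔prime : 𝔔.IsPrime := w.isPrime
  have h𝔔v : 𝔔.comap (algebraMap (𝒮 0) S) = v.asIdeal := by
    have h := congrArg PrimeSpectrum.asIdeal hw
    rwa [PrimeSpectrum.comap_asIdeal] at h
  -- the unit-degree subgroup of `𝔔`
  obtain ⟨B, hB, -⟩ := StabilizerSubgroup.exists_unitDegrees_addSubgroup 𝒮 hA 𝔔
  -- localize away from one degree-zero element
  obtain ⟨t, ht0, htQ, hT, hloc⟩ := AwayUnits.exists_away_units (k := k) 𝒮 𝔔 B hB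
  let L : Type := Localization.Away t
  obtain ⟨hprime, hcomap, hBL, houtL, hunitL⟩ := hloc L
  let ℒ : A → Submodule k L := locPiece 𝒮 (Submonoid.powers t) hT L
  letI instℒ : GradedAlgebra ℒ := (nonempty_gradedAlgebra_locPiece 𝒮 _ hT L).some
  set 𝔔L : Ideal L := 𝔔.map (algebraMap S L) with h𝔔L
  haveI : 𝔔L.IsPrime := hprime
  -- coarsen along `A → A/B`: `𝔔L` is a fixed point
  obtain ⟨ℒ', instℒ', hℒ', hle, hfix, -⟩ := Coarsening.exists_coarsening_fixed ℒ hA 𝔔L B hBL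
  -- the finite étale inclusion `(S_t)_0 → (S_t)^{(B)}`
  have hker : ∀ a : A, QuotientAddGroup.mk' B a = 0 ↔ a ∈ B := fun a =>
    QuotientAddGroup.eq_zero_iff a
  have hcardL : IsUnit ((Nat.card B : ℕ) : L) := by
    have hAL : IsUnit ((Nat.card A : ℕ) : L) := by
      have h := htame.map (algebraMap k L)
      rwa [map_natCast] at h
    exact isUnit_of_dvd_unit (Nat.cast_dvd_cast (AddSubgroup.card_addSubgroup_dvd_card B)) hAL
  obtain ⟨ι, hιval, hιet, -⟩ :=
    CoarseningEtale.exists_ringHom_etale_finite ℒ (QuotientAddGroup.mk' B) ℒ' hℒ' B hker hunitL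
      hcardL
  -- the localization on degree zero
  let j : 𝒮 0 →+* ℒ 0 := locPieceZeroHom 𝒮 (Submonoid.powers t) hT L
  have hjval : ∀ a, (j a : L) = algebraMap S L a := fun a => rfl
  have hjet : j.Etale := etale_locPieceZeroHom 𝒮 ht0 hT L
  -- the new chart
  let ψ : 𝒮 0 →+* ℒ' 0 := ι.comp j
  have hψet : ψ.Etale := RingHom.Etale.stableUnderComposition j ι hjet hιet
  have hψval : ∀ a, (ψ a : L) = algebraMap S L a := fun a => by
    show (ι (j a) : L) = _
    rw [hιval, hjval]
  haveI : Etale (Spec.map (CommRingCat.ofHom ψ)) :=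
    (HasRingHomProperty.Spec_iff (P := @Etale)).mpr hψet
  let φ' : Spec (.of (ℒ' 0)) ⟶ X := Spec.map (CommRingCat.ofHom ψ) ≫ φ
  -- compatibility with the structure maps
  have hψk : ψ.comp (algebraMap k (𝒮 0)) = algebraMap k (ℒ' 0) := by
    refine RingHom.ext fun c => Subtype.ext ?_
    show (ψ (algebraMap k (𝒮 0) c) : L) = (algebraMap k (ℒ' 0) c : L)
    rw [hψval, SetLike.GradeZero.coe_algebraMap, SetLike.GradeZero.coe_algebraMap,
      ← IsScalarTower.algebraMap_apply]
  have hφ'g : φ' ≫ g = Spec.map (CommRingCat.ofHom (algebraMap k (ℒ' 0))) := by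
    show (Spec.map (CommRingCat.ofHom ψ) ≫ φ) ≫ g = _
    rw [Category.assoc, hφg, ← Spec.map_comp, ← CommRingCat.ofHom_comp, hψk]
  -- the point
  let v' : Spec (.of (ℒ' 0)) := ⟨𝔔L.comap (algebraMap (ℒ' 0) L), inferInstance⟩
  have hv' : Spec.map (CommRingCat.ofHom ψ) v' = v := by
    apply PrimeSpectrum.ext
    rw [Spec.map_apply, PrimeSpectrum.comap_asIdeal]
    show (𝔔L.comap (algebraMap (ℒ' 0) L)).comap ψ = v.asIdeal
    rw [Ideal.comap_comap, ← h𝔔v, ← hcomap, Ideal.comap_comap]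
    congr 1
    ext a
    exact hψval a
  have hφ'v : φ' v' = φ v := by
    show φ (Spec.map (CommRingCat.ofHom ψ) v') = φ v
    rw [hv']
  haveI : Finite (A ⧸ B) := Finite.of_surjective _ (QuotientAddGroup.mk'_surjective B)
  refine ⟨A ⧸ B, inferInstance, inferInstance, inferInstance, L, inferInstance, inferInstance,
    ℒ', instℒ', ?_, ?_, φ', inferInstance, hφ'g, v', 𝔔L, hprime, rfl, hfix, hφ'v⟩
  · show Algebra.FiniteType k (Localization (Submonoid.powers t))
    infer_instance
  · exact isRegularRing_localization (Submonoid.powers t)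

end Summit.ResolutionOfSingularities.ResolutionOfSingularities.Theorems.FRationalResolution.FixedChart

end
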